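import Summits.MatrixMultiplication.OmegaCensus.SmallFormats.MatMul22nDoubleCellKill
import Summits.MatrixMultiplication.OmegaCensus.SmallFormats.MatMul22nGF3CountCertificatePlus
import HarnessLib

/-!
# ω-census family (a): the (9,30) marginal M2 (the P2 grid) is NOT the X-marginal of any 30-term `𝔽₃`-computation of `⟨2,2,9⟩`

Cell `pub-omega` (unit `pub-omega-tensor`, gen 40), topic `Summits/MatrixMultiplication/OmegaCensus` (sub-folder
`SmallFormats`). Framing (verbatim): lottery ticket; floor = certified bounds/negative ranges. HONEST FRAMING: one of the TWO prescribed
marginals of the loaded branch of the `(9,30)` funnel (tensor g39: GO #159 / landscape930 DATUM say the only integer phantoms at `(9,30)`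
are the orbits of M1 (all-ones grid) and M2 (the P2 grid `[[0,1,1,2],[1,1,1,1],[1,1,1,1],[2,1,1,0]]`); memo ALL4-SAT-g39 §1, representative
from `all4_930_reps.json`) is excluded IN THE KERNEL by tensor g40's deflation route (memo DEFLATION-g40 §7): the double cell (terms 19, 20,
X-form `E₁₂ + E₂₂`... see `M2`) with its row neighbours 18, 21 and column neighbours 16, 28 satisfies the hypotheses of
`DoubleCellKill.exists_deflation`, so some 27-term computation of `⟨2,2,8⟩` has X-marginal `M2` minus `{18, d, s}` (`d ∈ {19,20}`,
`s ∈ {16,28}`), and each of these four 27-term marginals has an invertible point orthogonal to 10 of its classes, against the half law plus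
one at `(8,27)` (`invLineCapHalfPlus_xMarginal`: at most 9). This is NOT yet a rank word: «31 ≤ R_𝔽₃(⟨2,2,9⟩)» still needs M1 and the cover
certificate «census clauses ⇒ marginal ∈ orbit(M1) ∪ orbit(M2)» (and orbit transport). Nothing on `ω`.
-/

namespace Summit.MatrixMultiplication.OmegaCensus.SmallFormats

open Finset Module Matrix
open Literature.Computability.AlgebraicComplexity
open Summit.MatrixMultiplication.OmegaCensus.RankOnePlaneCapGeneral

namespace NoM2

/-- **M2 is not an X-marginal** (the table is tensor g39's representative of the P2-grid orbit at `(9,30)`, `all4_930_reps.json`, terms in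
its order; stated as a literal so that this file carries no definition). -/
theorem xMarginal_ne_M2 (β : BilinComp (mulBilin (ZMod 3) 2 2 9) (Fin 30)) :
    xMarginal β ≠
    ![!![1, 0; 0, 1], !![0, 1; 1, 1], !![1, 2; 2, 0], !![0, 1; 1, 0], !![1, 0; 2, 1], !![0, 1; 1, 2], !![1, 2; 0, 2], !![0, 1; 2, 0], !![1, 2; 2, 2],
      !![0, 1; 2, 1], !![1, 2; 0, 1], !![1, 0; 2, 2], !![0, 1; 2, 2], !![1, 0; 0, 2], !![1, 0; 0, 0], !![0, 1; 0, 0], !![1, 1; 0, 0], !![1, 2; 0, 0],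
      !![0, 0; 1, 0], !![0, 0; 1, 1], !![0, 0; 1, 1], !![0, 0; 1, 2], !![1, 0; 1, 0], !![0, 1; 0, 1], !![0, 1; 0, 1], !![1, 2; 1, 2], !![1, 0; 2, 0],
      !![0, 1; 0, 2], !![1, 1; 2, 2], !![1, 2; 2, 1]] := by
  classical
  intro hM
  set M2 : Fin 30 → Matrix (Fin 2) (Fin 2) (ZMod 3) :=
    ![!![1, 0; 0, 1], !![0, 1; 1, 1], !![1, 2; 2, 0], !![0, 1; 1, 0], !![1, 0; 2, 1], !![0, 1; 1, 2], !![1, 2; 0, 2], !![0, 1; 2, 0], !![1, 2; 2, 2],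
      !![0, 1; 2, 1], !![1, 2; 0, 1], !![1, 0; 2, 2], !![0, 1; 2, 2], !![1, 0; 0, 2], !![1, 0; 0, 0], !![0, 1; 0, 0], !![1, 1; 0, 0], !![1, 2; 0, 0],
      !![0, 0; 1, 0], !![0, 0; 1, 1], !![0, 0; 1, 1], !![0, 0; 1, 2], !![1, 0; 1, 0], !![0, 1; 0, 1], !![0, 1; 0, 1], !![1, 2; 1, 2], !![1, 0; 2, 0],
      !![0, 1; 0, 2], !![1, 1; 2, 2], !![1, 2; 2, 1]] with hM2def
  -- plane data
  have hι : Fintype.card (Fin 30) ≤ 3 * (8 + 1) + 3 := by simp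
  have hR0 : ∀ i ∈ ({18, 19, 20, 21} : Finset (Fin 30)), Matrix.vecMul ![2, 0] (xMarginal β i) = 0 := by
    rw [hM]; decide
  have hR1 : ∀ i ∈ ({14, 15, 16, 17} : Finset (Fin 30)), Matrix.vecMul ![0, 1] (xMarginal β i) = 0 := by
    rw [hM]; decide
  have hR2 : ∀ i ∈ ({26, 27, 28, 29} : Finset (Fin 30)), Matrix.vecMul ![1, 1] (xMarginal β i) = 0 := by
    rw [hM]; decide
  have hC1 : ∀ i ∈ ({14, 18, 22, 26} : Finset (Fin 30)), Matrix.mulVec (xMarginal β i) ![0, 1] = 0 := by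
    rw [hM]; decide
  have hC2 : ∀ i ∈ ({17, 21, 25, 29} : Finset (Fin 30)), Matrix.mulVec (xMarginal β i) ![1, 1] = 0 := by
    rw [hM]; decide
  have hC3 : ∀ i ∈ ({16, 19, 20, 28} : Finset (Fin 30)), Matrix.mulVec (xMarginal β i) ![2, 1] = 0 := by
    rw [hM]; decide
  have hfd : β.f 19 = β.f 20 := by
    rw [← xMarginal_eq_iff, hM]; decide
  obtain ⟨d, s, hd, hs, β', e, he, heJ, hf'⟩ := DoubleCellKill.exists_deflation (n := 8) (by norm_num) β hι
    ![2, 0] ![0, 1] ![1, 1]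
    ![0, 1] ![1, 1] ![2, 1]
    (by decide) (by decide) (by decide) (by decide) (by decide) (by decide) (by decide) (by decide) (by decide)
    {18, 19, 20, 21} {14, 15, 16, 17} {26, 27, 28, 29} {14, 18, 22, 26} {17, 21, 25, 29} {16, 19, 20, 28}
    (by decide) (by decide) (by decide) (by decide) (by decide) (by decide) hR0 hR1 hR2 hC1 hC2 hC3
    18 21 19 20 16 28
    (by decide) (by decide) (by decide) (by decide) (by decide) (by decide) (by decide) (by decide) (by decide) (by decide)
    (by decide) (by decide) (by decide) hfd (by decide) (by decide) (by decide) (by decide) (by decide) (by decide) (by decide)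
  -- the deflated 27-term computation has X-marginal M2 ∘ e
  have hxm : ∀ a, xMarginal β' a = M2 (e a) := by
    intro a; rw [← congrFun hM (e a)]; ext c d'; rw [xMarginal_apply, xMarginal_apply, hf' a]
  -- image of e = complement of J
  have hJ3 : ({18, d, s} : Finset (Fin 30)).card = 3 := by
    rcases hd with rfl | rfl <;> rcases hs with rfl | rfl <;> decide
  have himg : Finset.univ.image e = Finset.univ \ ({18, d, s} : Finset (Fin 30)) := by
    apply Finset.eq_of_subset_of_card_le
    · intro i hi
      obtain ⟨a, -, rfl⟩ := Finset.mem_image.mp hi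
      exact Finset.mem_sdiff.mpr ⟨Finset.mem_univ _, heJ a⟩
    · rw [Finset.card_univ_sdiff, Finset.card_image_of_injective _ he, Finset.card_univ, Fintype.card_fin, Fintype.card_fin]
  -- count of classes orthogonal to X₀ in the deflated marginal
  have hcount : ∀ X₀ : Matrix (Fin 2) (Fin 2) (ZMod 3),
      (Finset.univ.filter fun a => dotX (mflat (xMarginal β' a)) X₀ = 0).card =
        ((Finset.univ \ ({18, d, s} : Finset (Fin 30))).filter fun i => dotX (mflat (M2 i)) X₀ = 0).card := by
    intro X₀
    rw [← himg, Finset.filter_image, Finset.card_image_of_injective _ he]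
    congr 1
    ext a
    simp [hxm]
  have hcap := fun X₀ hX₀ => Enum723.invLineCapHalfPlus_xMarginal (n := 8) (by rw [Fintype.card_fin, hJ3]; norm_num) β' X₀ hX₀
  -- the four cases: a hot invertible point with 10 orthogonal classes
  rcases hd with rfl | rfl <;> rcases hs with rfl | rfl
  · have h := hcap !![0, 1; 2, 2] (by decide)
    rw [hcount, Fintype.card_fin, hJ3] at h
    have hc : ((Finset.univ \ ({18, 19, 16} : Finset (Fin 30))).filter fun i => dotX (mflat (M2 i)) !![0, 1; 2, 2] = 0).card = 10 := by
      decide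
    omega
  · have h := hcap !![1, 2; 1, 1] (by decide)
    rw [hcount, Fintype.card_fin, hJ3] at h
    have hc : ((Finset.univ \ ({18, 19, 28} : Finset (Fin 30))).filter fun i => dotX (mflat (M2 i)) !![1, 2; 1, 1] = 0).card = 10 := by
      decide
    omega
  · have h := hcap !![0, 1; 2, 2] (by decide)
    rw [hcount, Fintype.card_fin, hJ3] at h
    have hc : ((Finset.univ \ ({18, 20, 16} : Finset (Fin 30))).filter fun i => dotX (mflat (M2 i)) !![0, 1; 2, 2] = 0).card = 10 := by
      decide
    omega
  · have h := hcap !![1, 2; 1, 1] (by decide)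
    rw [hcount, Fintype.card_fin, hJ3] at h
    have hc : ((Finset.univ \ ({18, 20, 28} : Finset (Fin 30))).filter fun i => dotX (mflat (M2 i)) !![1, 2; 1, 1] = 0).card = 10 := by
      decide
    omega

end NoM2

end Summit.MatrixMultiplication.OmegaCensus.SmallFormats
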